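import Literature.NumberTheory.EllipticCurves.AnalyticRank
import HarnessLib

/-!
# Crux `PlecticLegs.PlecticPointsLB` (stmt-BirchSwinnertonDyer-17518), line `conjugate-pigeonhole` —
# stub A `stub_factorOrders`: exact total order `d` over `d` vanishing factors forces order one

Registered stub A of `Cruxes/PlecticPointsLB/Lines/sketch_conjugate_pigeonhole.lean` for crux
stmt-BirchSwinnertonDyer-17518
(`Summit.BirchSwinnertonDyer.BirchSwinnertonDyer.Theses.PlecticLegs.PlecticPointsLB`, route
`PlecticLegs`): the analytic lever of the line.

For a Weierstrass curve `V` over a number field `F`, suppose `V.entireLFunction` agrees on the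
half-plane `Re s > 3/2` with a product `∏ i, g i s` of `d ≥ 1` entire functions `g i : ℂ → ℂ`, all
vanishing at `s = 1`, and `V.analyticRank = d`. Then every factor vanishes to order EXACTLY one at
`s = 1`: `analyticOrderAt (g i) 1 = 1` for all `i`.

## Proof

* The product `G s = ∏ i, g i s` is entire and agrees with `V.LSeries` on `Re s > 3/2` (there
  `V.entireLFunction = V.LSeries` in both branches of the definition of `entireLFunction`), so
  `G ∈ V.entireContinuations`; hence `V.HasEntireLFunction`, and by uniqueness of the entire
  continuation (`WeierstrassCurve.subsingleton_entireContinuations`, the identity theorem)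
  `V.entireLFunction = G` on all of `ℂ`.
* `analyticOrderAt` is additive over finite products of analytic functions
  (`factorOrders_analyticOrderAt_finset_prod`, induction over Mathlib's `analyticOrderAt_mul`), so
  `∑ i, analyticOrderAt (g i) 1 = analyticOrderAt G 1 = d` (the order is finite since its `toNat`
  is `d > 0`).
* Each summand is `≥ 1` (`g i` is analytic at `1` with `g i 1 = 0`) and finite; `d` naturals `≥ 1`
  summing to `d` are all equal to `1` (`Finset.sum_eq_sum_iff_of_le`).
-/

set_option linter.dupNamespace false -- single-conjunct summit: Sub = Summit (D-0017)

namespace Summit.BirchSwinnertonDyer.BirchSwinnertonDyer.Theorems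

/-- **Additivity of the order of vanishing over finite products.** For functions `g i : ℂ → ℂ`
analytic at `z₀` (`i ∈ s`), `ord_{z₀} (∏_{i ∈ s} g i) = ∑_{i ∈ s} ord_{z₀} (g i)` in `ℕ∞`
(induction on `s` over Mathlib's `analyticOrderAt_mul`; the empty product is the constant `1`, of
order `0`). [folklore] -/
theorem factorOrders_analyticOrderAt_finset_prod {ι : Type*} (s : Finset ι) {g : ι → ℂ → ℂ}
    {z₀ : ℂ} (hg : ∀ i ∈ s, AnalyticAt ℂ (g i) z₀) :
    analyticOrderAt (fun z => ∏ i ∈ s, g i z) z₀ = ∑ i ∈ s, analyticOrderAt (g i) z₀ := by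
  classical
  induction s using Finset.induction_on with
  | empty => simp [analyticOrderAt_eq_zero]
  | insert a s ha ih =>
    have hga : AnalyticAt ℂ (g a) z₀ := hg a (Finset.mem_insert_self a s)
    have hg' : ∀ i ∈ s, AnalyticAt ℂ (g i) z₀ := fun i hi => hg i (Finset.mem_insert_of_mem hi)
    have hprod : AnalyticAt ℂ (fun z => ∏ i ∈ s, g i z) z₀ := s.analyticAt_fun_prod hg'
    have heq : (fun z => ∏ i ∈ insert a s, g i z) = g a * fun z => ∏ i ∈ s, g i z := by
      funext z
      rw [Finset.prod_insert ha]
      rfl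
    rw [heq, analyticOrderAt_mul hga hprod, ih hg', Finset.sum_insert ha]

/-- **A · `stub_factorOrders` — the analytic lever of line `conjugate-pigeonhole`.** For a
Weierstrass curve `V` over a number field `F`, if `V.entireLFunction` agrees on `Re s > 3/2` with a
product of `d ≥ 1` entire functions `g i` all vanishing at `s = 1`, and `V.analyticRank = d`, then
every factor vanishes to order EXACTLY one at `s = 1`. The factorisation bootstraps
`V.HasEntireLFunction` and upgrades to the global identity `V.entireLFunction = ∏ i, g i` through
`WeierstrassCurve.subsingleton_entireContinuations` (identity theorem); then pigeonhole (`d`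
factors, each of order `≥ 1`, total order `d`) over the additivity of `analyticOrderAt` on finite
products. [folklore] -/
theorem stub_factorOrders :
    ∀ (F : Type) [Field F] [NumberField F] (V : WeierstrassCurve F) (d : ℕ) (g : Fin d → ℂ → ℂ),
      0 < d → (∀ i, Differentiable ℂ (g i)) →
      (∀ s : ℂ, (3 / 2 : ℝ) < s.re → V.entireLFunction s = ∏ i, g i s) →
      (∀ i, g i 1 = 0) → V.analyticRank = d → ∀ i, analyticOrderAt (g i) 1 = 1 := by
  intro F _ _ V d g hd hg hfac hz hran
  -- The product of the factors, an entire function.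
  set G : ℂ → ℂ := fun s => ∏ i, g i s
  have hGdiff : Differentiable ℂ G := Differentiable.fun_finsetProd fun i _ => hg i
  -- On the half-plane of absolute convergence `V.entireLFunction` is the L-series, in both
  -- branches of its definition (continuation chosen / junk value `V.LSeries`).
  have hLS : ∀ s : ℂ, (3 / 2 : ℝ) < s.re → V.entireLFunction s = V.LSeries s := by
    intro s hs
    by_cases h : V.HasEntireLFunction
    · exact V.entireLFunction_eq_LSeries h hs
    · have h' : ¬ (WeierstrassCurve.entireContinuations V).Nonempty := h
      have hjunk : V.entireLFunction = V.LSeries := by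
        unfold WeierstrassCurve.entireLFunction
        rw [dif_neg h']
      rw [hjunk]
  -- Hence `G` is an entire continuation of `L(V,s)`, and by uniqueness it IS `V.entireLFunction`.
  have hGmem : G ∈ V.entireContinuations :=
    ⟨hGdiff, fun s hs => by rw [← hLS s hs, hfac s hs]⟩
  have hV : V.HasEntireLFunction := ⟨G, hGmem⟩
  have hEG : V.entireLFunction = G :=
    V.subsingleton_entireContinuations (V.entireLFunction_mem hV) hGmem
  -- Total order of vanishing of `G` at `1`: `d`, finite and positive.
  have hranG : analyticOrderNatAt G 1 = d := by
    rw [← hEG]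
    exact hran
  have hGtop : analyticOrderAt G 1 ≠ ⊤ := by
    intro htop
    have h0 : analyticOrderNatAt G 1 = 0 := by
      simp [analyticOrderNatAt, htop]
    omega
  have hGd : analyticOrderAt G 1 = (d : ℕ∞) := by
    rw [← Nat.cast_analyticOrderNatAt hGtop, hranG]
  -- Additivity: the orders of the factors sum to `d`.
  have han : ∀ i, AnalyticAt ℂ (g i) 1 := fun i => (hg i).analyticAt 1
  have hsumE : ∑ i, analyticOrderAt (g i) 1 = (d : ℕ∞) := by
    rw [← factorOrders_analyticOrderAt_finset_prod Finset.univ fun i _ => han i]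
    exact hGd
  -- Each order is finite and nonzero.
  have hsum_ne_top : ∑ i, analyticOrderAt (g i) 1 ≠ ⊤ := by
    rw [hsumE]
    exact ENat.coe_ne_top d
  have htop : ∀ i, analyticOrderAt (g i) 1 ≠ ⊤ := fun i =>
    WithTop.sum_ne_top.1 hsum_ne_top i (Finset.mem_univ i)
  have hne0 : ∀ i, analyticOrderAt (g i) 1 ≠ 0 := fun i =>
    analyticOrderAt_ne_zero.2 ⟨han i, hz i⟩
  -- Pass to natural numbers: `d` naturals, each `≥ 1`, summing to `d`, are all `1`.
  have hn : ∀ i, ((analyticOrderNatAt (g i) 1 : ℕ) : ℕ∞) = analyticOrderAt (g i) 1 := fun i =>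
    Nat.cast_analyticOrderNatAt (htop i)
  have hsumN : ∑ i, analyticOrderNatAt (g i) 1 = d := by
    have h : ((∑ i, analyticOrderNatAt (g i) 1 : ℕ) : ℕ∞) = (d : ℕ∞) := by
      rw [Nat.cast_sum]
      simp_rw [hn]
      exact hsumE
    exact_mod_cast h
  have hone : ∀ i, 1 ≤ analyticOrderNatAt (g i) 1 := by
    intro i
    rw [Nat.one_le_iff_ne_zero]
    intro h0
    apply hne0 i
    rw [← hn i, h0, Nat.cast_zero]
  have hall : ∀ i ∈ (Finset.univ : Finset (Fin d)), 1 = analyticOrderNatAt (g i) 1 :=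
    (Finset.sum_eq_sum_iff_of_le fun i _ => hone i).1 (by simp [hsumN])
  intro i
  rw [← hn i, ← hall i (Finset.mem_univ i), Nat.cast_one]

end Summit.BirchSwinnertonDyer.BirchSwinnertonDyer.Theorems
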